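import Summits.BirchSwinnertonDyer.BirchSwinnertonDyer.Theorems.ByReductionTypeAtTwoAdditiveKatoExceptionalPrimeDefs
import Summits.BirchSwinnertonDyer.BirchSwinnertonDyer.Theorems.ByReductionTypeAtTwoUniformKatoHalfSharpAll
import Literature.NumberTheory.EllipticCurves.Kato2004.DivisibilityInputsMultiplicative
import Literature.NumberTheory.EllipticCurves.Greenberg1999.CharIdealInvolutionBaseChange
import Literature.NumberTheory.EllipticCurves.PAdicLFunctionMinusMult
import HarnessLib

/-!
# Route ByReductionTypeAtTwo, crux `AdditiveRankZeroAtTwo` (stmt-BirchSwinnertonDyer-19098) — the TRANSPORT road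
# (repair-census R-B78): Kato's Conj. 12.10 at the ONE exceptional prime of (12.5.1) on the additive split-twist
# classes FOLLOWS from Kato's own bound at the `ι`-conjugate prime, Greenberg's `ι`-invariance of `char X`
# (LNM 1716 Thm. 1.14, PRINT) and the functional equation of the `2`-adic `L`-function (MTT §I.17, PRINT);
# the target `KatoSharpAtTwoAdditiveSplitTwist` (T19) is split into its (−1)- and (−2)-blocks, and the ONE
# object-level input at `p = 2` — the ODD-BRANCH Kato–Coleman package of the split-multiplicative twist — is
# typed on Kato's objects (twin of the multiplicative lane's `MultKatoInputs.exists_multDivisibilityInputs_split_two`)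

Seat `bsd-2adic-addL2x` GEN 16 (2026-08-28/29; pattern of `…AdditiveKatoExceptionalPrimeDefs.lean` (GEN 15) and of
`…MultKatoInputsDefs.lean` (mult lane); pen ruling RC-307 (β): statements at `p = 2` beyond the printed range are
Summits-side `@[conjecture]` constants consumed BY NAME). HONEST FRAMING (cell `bsd-2adic`, HUMAN RULING
D-0036/D-0054): THREE typed constants (nothing asserted) and pure-logic doors; types-the-object-of; closes none;
nothing booked; BSD is not proved by any of this. PARTITION: X5@2 additive (−1)-split (169 classes, 128 with
irreducible `E[2]`) and (−2)-split (39, 30) sub-blocks × `p = 2`.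

## T20 — the transport argument (numbering continues T1–T19 of the lane's Kato-at-`2` table)

Setting of T15–T19: `E = W` additive at `2` with `E' := E^{(−1)}` SPLIT multiplicative at `2` (the (−2)-block is
word for word the same with `χ_{−2} = ω·χ₂` for `ω = χ_{−1}`, see T20 (f)), `E[2] = E'[2]` irreducible,
`L(E,1) ≠ 0`. `Λ = ℤ₂⟦G_∞⟧`, `G_∞ = Gal(ℚ(ζ_{2^∞})/ℚ) = Δ × Γ`, `Δ = {±1}`, `Γ ↔ 1 + 4ℤ₂ ∋ 5 ↔ γ = 1 + T`,
`Λ' = ℤ₂⟦T⟧ = IwasawaAlgebra 2`; at the height-one primes `𝔮 ∌ 2` everything splits into the two `Δ`-branches,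
and `T₂E = T₂E' ⊗ ω` puts `E`'s cyclotomic Iwasawa theory over `ℚ_∞ = ℚ(ζ_{2^∞})⁺` in the ODD (`ω`-) branch of
Kato's two-variable objects for `f = f_{E'}`. The exceptional prime of (12.5.1) is
`𝔮₀ = (γ − κ(γ)^{−1}) = (T + 4/5)` (`H²_Iw(ℚ₂, T₂E) ≅ ℤ₂(−1)^∨-twist = Λ'/𝔮₀`, 13.13), its conjugate
`ι𝔮₀ = (γ − κ(γ)) = (T − 4)` (`ι : γ ↦ γ^{−1}`, the tree's `IwasawaAlgebra.invol`) carries NO local term.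

* **(a) Symmetry of `char X` (PRINT + reading).** `X := X(E/ℚ_∞)` (dual Selmer, tree `W.SelmerDualData κ γ`;
  `=` the Greenberg-condition dual away from `(2)`: at the unique prime of `ℚ_n` above `2` the Greenberg and
  Kummer conditions for `T₂E ⊃ T⁺ = ℤ₂(κω)` differ by groups of order `≤ 4` at every layer — `H¹(ℚ_{2,n},A⁺)/div
  ≅ ℤ/2`, `H¹(𝔽, (A⁻)^{I}) = ℤ/2`). With `F = ℚ(i)`, `F_∞ = ℚ(ζ_{2^∞})`, `Gal(F_∞/F) = Γ`: restriction along the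
  quadratic layer `F_∞/ℚ_∞` (group `Δ`) gives `X(E'/F_∞) ≐ X(E'/ℚ_∞) ⊕ X(E/ℚ_∞)` as `Λ'`-modules UP TO MODULES
  KILLED BY `4` (`E'(F_∞)[2] = 0` because `ℚ(E[2])/ℚ` is an `S₃`- or `C₃`-extension, so inflation–restriction is
  an isomorphism on `H¹`; the local conditions differ by `H¹(Δ_w, E(F_{∞,w}))`, killed by `2`; `M ⊇ M^Δ + M^{−}
  ⊇ 2M` and `M^{−} = (M ⊗ ω)^Δ`), hence `char_{Λ'} X(E'/F_∞) ≐ char X(E'/ℚ_∞) · char X(E/ℚ_∞)` away from `(2)`.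
  Greenberg, LNM 1716 Thm. 1.14 «for any F» (PRINT; tree `Greenberg1999.thm114_charIdeal_iota_invariant_splitMult_baseChange`,
  `E'/F` split multiplicative at `(1+i)`) and over `ℚ` (PRINT; tree `Greenberg1999_thm114_charIdeal_iota_invariant`)
  make the first two characteristic ideals `ι`-stable (both torsion: `X(E'/ℚ_∞)` by Kato–Rohrlich for the split
  multiplicative `E'` of ANY rank — the multiplicative lane's `MultKatoInputs.exists_multDivisibilityInputs_split_two`
  gives it at `2` —, `X(E/ℚ_∞)` by (b)); `Λ'` is a UFD, so `char X(E/ℚ_∞)` is `ι`-stable away from `(2)`, and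
  KERNEL `Kato2004.lengthAt_eq_comap_invol_of_map_invol_charIdeal_eq` reads it prime by prime:
  **`ℓ_{𝔮₀}(X) = ℓ_{ι𝔮₀}(X)`**.
* **(b) The odd-branch §17.13 package (the ONE input owed at `p = 2`; §1 below).** For `f_{E'}` Kato's §16.1
  holds with `α = a₂(E') = 1` (`ord₂ α = 0 < 1`, printed for `p ∣ N`, no parity hypothesis), so Thm. 16.2 (the
  Mazur–Tate–Teitelbaum measure, tree `padicLFunctionMinusBranchMult f 1 1 = L⁻` for the odd branch, ONE-term
  measure at `2 ∥ N'`) and Thm. 16.6 (2) «`L_{p-adic,α,ω,γ}(f) = 𝔏_η(z_γ^{(p)}(f*)(k))`» give, on the odd branch and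
  after `⊗ω` (full tower, then `Δ`-descent, exact up to `×2`): Perrin-Riou's `𝔏` on `P := im(H¹_Iw(ℚ₂,T₂E) →
  H¹_Iw(ℚ₂,T⁻))` (`T⁻ = ℤ₂(ω)`, rank one, torsion free) carries `loc z_E` to `L⁻` up to `2ⁿ·unit`. The local
  structure at `2` (local duality and the twist `H^i_Iw(ℤ₂) = H^i_Iw(ℤ₂(1)) ⊗ (−1)`, 13.13): `H²_Iw(ℚ₂,T⁻) = Λ'/𝔮₀`
  and the universal-norm (Coleman) submodule `U ⊂ P` has colength `Λ'/𝔮₀` AT THE SAME PRIME, while Coleman's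
  kernel/cokernel `ℤ₂(1)` of `U_∞ → Λ` sit, after the twist, in the EVEN branch (the twist's own exceptional
  zero) — so on the odd branch `col := (T + 4/5)·𝔏 : P → Λ'` is injective with cokernel of length `0` at every
  height-one `𝔮 ∌ 2`, and `G := col(loc z_E) ≐ 2ⁿ·(T + 4/5)·L⁻`. With Kato's Thm. 12.4, 12.5 (1)–(3), 12.6 for
  `f_E` itself (any reduction, any `p`; the local term of 12.5 (3) has length `1` at `𝔮₀` and `0` elsewhere) and
  the Poitou–Tate sequence (17.13.1) for the Greenberg condition («exact upto ×2 in the case p = 2», 14.9), this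
  is EXACTLY a `Kato2004.MultDivisibilityInputs W 2 ((T+4/5)·L⁻) κ γ I D` with `ℓ_𝔮(Λ'/col P) = 0` off `(2)` —
  the constant `KatoOddBranchInputsAtTwoNegOneSplitTwist` of §1 (conjecture-grade at `2` exactly like the
  multiplicative lane's K11b; every field is print at an odd prime).
* **(c) Kato at the clean prime.** From the package at `ι𝔮₀` (no local term, `col` onto): §17.13's identity
  `ℓ(X) + ℓ(𝐇¹/z) = ℓ(Λ'/(G)) + ℓ(𝐇²)` (KERNEL `Kato2004.lengthAt_add_eq_of_skeleton`) and Thm. 12.5 (3)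
  `ℓ(𝐇²) ≤ ℓ(𝐇¹/z)` give `ℓ_{ι𝔮₀}(X) ≤ ℓ_{ι𝔮₀}(Λ'/(G)) = ord_{ι𝔮₀} L⁻` (KERNEL `Kato2004.lengthAt_X_le_of_skeleton_clean`).
* **(d) Functional equation (PRINT).** MTT §I.17: `ι L⁻ = w·σ_{N'}^{−1}·L⁻`, a UNIT multiple in `Λ'` (the
  involution preserves the `ω`-branch since `ω^{−1} = ω`); KERNEL `Kato2004.lengthAt_quotient_span_eq_comap_invol_of_invol_eq_unit_mul`:
  **`ord_{𝔮₀} L⁻ = ord_{ι𝔮₀} L⁻`**, and `(T + 4/5)` is a unit at `ι𝔮₀`, `(T − 4)` at `𝔮₀`.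
* **(e) Conclusion (KERNEL `Kato2004.lengthAt_H2_le_of_transport_exceptional` / `…_of_invol_transport_exceptional`).**
  (a)+(c)+(d): `ℓ_{𝔮₀}(X) ≤ ord_{𝔮₀} L⁻`; §17.13's identity at `𝔮₀` in its exceptional shape (local term `1` and
  Coleman excess `1` cancel: KERNEL `Kato2004.lengthAt_add_eq_of_skeleton_exceptional`, GEN 15) turns this into
  **Conj. 12.10's inequality at `𝔮₀`: `ℓ_{𝔮₀}(𝐇²) ≤ ℓ_{𝔮₀}(𝐇¹/z)`** — the one prime where Thm. 12.5 (4) does not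
  print it. Feeding it to the descent (KERNEL `Kato2004.natCard_coinvariants_le_index_zeta_of_transport`, the
  `d = 0` case of GEN 15's `…_off_prime`) the readings T1–T14 run word for word: the `+2` of T18 (and the `+1` of
  T17 on the (−2)-block) DISAPPEARS. No `2`-adic `L`-VALUE is needed (GEN 15's R-B78 (c) used the certificate
  `L₂(E')(κ^{±1}) ≠ 0`; the functional equation makes it unnecessary — the certificate, kit j316397/j316885/j316889/
  j318498/j318935/j318939/j320398/j320399, 81/81 + this GEN's rows non-zero, now proves the STRONGER `ℓ_{𝔮₀}(X) = 0`,
  i.e. 12.10 with equality at `𝔮₀`).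
* **(f) The (−2)-block.** `E = E'' ⊗ χ_{−2}`, `E'' := E^{(−2)}` split multiplicative, `χ_{−2} = ω·χ₂` with `χ₂` the
  character of `ℚ(√2) = ℚ₁ ⊂ ℚ_∞`: the same argument with `F = ℚ(√−2)` (`F_∞ = ℚ(ζ_{2^∞})`, `Gal(F_∞/F) ↔ ⟨−5⟩`),
  the `χ₂`-TWISTED odd branch `∫ χ_{−2}(x)(1+T)^{ℓ(x)} dμ⁻_{E''}` and `𝔮₀ = (γ + κ(γ)^{−1}) = (T + 6/5)`,
  `ι𝔮₀ = (T + 6)`. Not typed at object level here ONLY because that branch of the one-term measure has no tree name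
  (vocabulary gap; `X5.AddTwoL2Cyc.padicLFunctionMinusChi8` is the two-term `p ∤ N` version).

STATUS / WHAT IS NOT CLAIMED. (a) twist decomposition and (b) are READINGS at `2` ((b) typed, §1; its print is
Kato §16 + Kobayashi 2006 Thm. 4.1 / Wuthrich 2014 at ODD `p`); Greenberg 1.14 ×2, MTT §I.17, Kato 12.4–12.6/16.2/
16.6 are PRINT; (c)(d)(e) are KERNEL (`Kato2004/ExceptionalPrimeInvolutionTransportProofs.lean`, this GEN, +
GEN 15's `ZetaIndexInequalityExceptionalPrimeProofs.lean`). So the (−1)-block target below is READING-GRADE MODULO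
§1 (no longer «Kato's Conj. 12.10 at a prime no Euler system sees»); the `@[conjecture]` tags stay per RC-307 (β)
until the pen/audit-2 rule. Nothing for reducible `E[2]`, CM, analytic rank `1`, lower bounds; statement (A) at
`(E,2)` remains a hypothesis of every Kato-side statement of the lane.

References: [Kato2004Asterisque] §12.2, Thm. 12.4, Thm. 12.5 (1)–(4) with (12.5.1), 12.6 (pp. 219–222), 13.13
(pp. 233–234), 14.9 (p. 239), §16.1, Thm. 16.2, 16.4, 16.6 (pp. 268–271), §17.13 (pp. 279–280); [GreenbergLNM1716]
Thm. 1.14 (p. 68), §2 (pp. 81–82); [Greenberg1989] Thm. 2; [MazurTateTeitelbaum1986Invent] §I.10, §I.13, §I.17;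
[Kobayashi2006DocMath] Thm. 4.1; [Wuthrich2014] p. 391; [CoatesSujatha2005] statement (A); memo
`run/shared/lean/pub/bsd-2adic/addL2x/VERDICT-19098-addL2x-GEN16.md`.
-/

set_option autoImplicit false
-- the summit's namespace `Summit.BirchSwinnertonDyer.BirchSwinnertonDyer` (Sub = Summit) trips `dupNamespace`
set_option linter.dupNamespace false

noncomputable section

open scoped Classical MatrixGroups ModularForm

open Field CongruenceSubgroup WeierstrassCurve Literature.NumberTheory.EllipticCurves
  Literature.NumberTheory.EllipticCurves.ModularForms

namespace Summit.BirchSwinnertonDyer.BirchSwinnertonDyer.Theorems.AddKatoTwo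

/-! ## §1 The odd-branch Kato–Coleman package at `2` (the ONE object-level input of T20) -/

/-- [crux input, MEMO] **The ODD-BRANCH §17.13 package at `p = 2` for an additive curve whose twist by `−1` is split
multiplicative at `2`** — typed research target, twin of `MultKatoInputs.exists_multDivisibilityInputs_split_two`
(nothing asserted). For every globally minimal `W/ℚ` with `W^{(−1)}` SPLIT multiplicative at `2` and `W[2]`
irreducible, the cyclotomic `ℤ₂`-extension `κ` with generator `γ` matching the cyclotomic variable (`κ_cyc(γ) = 5`),
every newform `f` of `W^{(−1)}`, every pinned `I = 𝐇¹_Γ(T₂W)` and dual Selmer datum `D` (`D.X = X(W/ℚ_∞)`): there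
is a `Kato2004.MultDivisibilityInputs W 2 L κ γ I D` for `L = (T + 4/5)·L⁻`, `L⁻ = padicLFunctionMinusBranchMult f 1 1`
the `ω`-branch of the ONE-term Mazur–Tate–Teitelbaum measure of `W^{(−1)}` (`α = a₂ = 1`), whose Coleman map
has cokernel of length `0` at every height-one `𝔮 ∌ 2` and whose local term `H2loc` (Thm. 12.5 (3); `= Λ'/𝔮₀`,
`𝔮₀ = (5T + 4)`, by 13.13) has length `0` at every height-one `𝔮 ∌ 2` except at most ONE prime `𝔮₀` with
`𝔮₀ = (5T+4)` or `𝔮₀ = (T−4)` (both spellings allowed: the tree's contragredient `Λ`-action on `D.X` may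
exchange `𝔮₀` and `ι𝔮₀`; T20 is symmetric in the two). CONTENT = T20 (b) of the module docstring: Kato 12.4 /
12.5 (1)–(3) / 12.6 for `f_W` (any reduction, any `p`), (17.13.1) «exact upto ×2», 13.13, and Thm. 16.2/16.6 for
`f_{W^{(−1)}}` (§16.1 with `α = 1`) transported to the odd branch by `T₂W = T₂W^{(−1)} ⊗ ω`; the Coleman clause
(injective, cokernel of length `0` off `(2)` after the factor `(T + 4/5)`) is the odd-branch twin of Kobayashi
2006 Thm. 4.1 — printed for ODD `p` only, whence conjecture-grade at `2` (the multiplicative lane's memos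
PROOF-KATO2MULT / PROOF-KATO2SPLIT treat the even branch). The (−2)-block twin needs the `χ_{−2}`-branch of the
one-term measure (vocabulary gap, T20 (f)).
[cite: Kato2004Asterisque, Thm. 12.4 (1) (p. 221), Thm. 12.5 (1)–(3) with (12.5.1) (pp. 221–222), Thm. 12.6 (p. 222), 13.13 (pp. 233–234), §16.1 and Thm. 16.2, 16.6 (pp. 268–271), §17.13 (pp. 279–280)]
[cite: Kobayashi2006DocMath, Thm. 4.1 (Coleman map of the Tate curve; odd p)] [cite: MazurTateTeitelbaum1986Invent, §I.10 and §I.13] -/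
@[conjecture] def KatoOddBranchInputsAtTwoNegOneSplitTwist : Prop :=
  ∀ (W : WeierstrassCurve ℚ) [W.IsElliptic] [W.IsGloballyMinimal]
    [ContinuousSMul ℤ_[2] (W.tateModule 2)] {N : ℕ} [NeZero N] (f : CuspForm (Gamma0 N) 2)
    (κ : ZpExtension ℚ 2) (γ : absoluteGaloisGroup ℚ),
    (W.quadraticTwist (-1)).HasSplitMultiplicativeReductionAtPrime 2 → W.HasIrreducibleModPGaloisRep 2 →
    κ.IsCyclotomic → κ.IsTopGenerator γ → IsCyclotomicVariable 2 γ → IsNewformOf (W.quadraticTwist (-1)) f →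
    ∀ (I : Kato2004.IwasawaH1Data W 2 κ γ) (D : W.SelmerDualData κ γ),
      ∃ (π : IwasawaAlgebra 2),
        (π = PowerSeries.C (5 : ℤ_[2]) * PowerSeries.X + PowerSeries.C 4 ∨
          π = PowerSeries.X - PowerSeries.C 4) ∧
        ∃ K : Kato2004.MultDivisibilityInputs W 2
            (iwasawaToPowerSeries 2 π * padicLFunctionMinusBranchMult f (1 : ℚ_[2]) 1) κ γ I D,
          (∀ 𝔮 : PrimeSpectrum (IwasawaAlgebra 2), 𝔮.asIdeal.height = 1 →
              PowerSeries.C (2 : ℤ_[2]) ∉ 𝔮.asIdeal →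
              Module.lengthAt (IwasawaAlgebra 2) (IwasawaAlgebra 2 ⧸ LinearMap.range K.col) 𝔮 = 0) ∧
          (∀ 𝔮 : PrimeSpectrum (IwasawaAlgebra 2), 𝔮.asIdeal.height = 1 →
              PowerSeries.C (2 : ℤ_[2]) ∉ 𝔮.asIdeal → 𝔮.asIdeal ≠ Ideal.span {π} →
              Module.lengthAt (IwasawaAlgebra 2) K.H2loc 𝔮 = 0)

/-! ## §2 The target T19 split into its (−1)- and (−2)-blocks -/

/-- [crux, MEMO] **The SHARP Kato-at-`2` bound on the additive (−1)-split-twist block** (169 X5@2 classes, 128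
with irreducible `E[2]`): for every globally minimal non-CM `W/ℚ` ADDITIVE at `2` whose twist by `−1` is SPLIT
multiplicative at `2`, `E[2]` irreducible, statement (A) at `(E,2)` (the `∃ γ D` spelling), `L(E,1) ≠ 0`, `Ш(E/ℚ)`
finite: `L(E,1)/Ω(W) = q ∈ ℚ` with `ord₂ #Ш(E/ℚ)(2) + v₂(Tam(W)) ≤ ord₂ q`. Same conclusion and binders as
`KatoSharpAtTwoAdditiveSplitTwist` (T19) on the (−1)-block. CONTENT = T20 (module docstring): the lane's readings
T1–T17 run with Kato's printed Thm. 12.5 (3) AND Conj. 12.10's inequality at the exceptional prime `𝔮₀ = (T+4/5)`,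
the latter now DERIVED — transport from the `ι`-conjugate prime `(T−4)` (Greenberg LNM 1716 Thm. 1.14 over `ℚ`
and over `ℚ(i)` for `W^{(−1)}`, PRINT; MTT §I.17, PRINT; kernel
`Kato2004/ExceptionalPrimeInvolutionTransportProofs.lean`) — so that this constant FOLLOWS from
{`KatoOddBranchInputsAtTwoNegOneSplitTwist` (§1, the one input owed at `2`), the torsion of `X(W^{(−1)}/ℚ_∞)`
(multiplicative lane, `MultKatoInputs.exists_multDivisibilityInputs_split_two`), PRINT, KERNEL, the twist-
decomposition reading T20 (a), readings T1–T17}. STATUS: reading-grade modulo §1 (was: Kato's Conj. 12.10 at a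
prime no Euler-system argument sees, GEN 15); tag `@[conjecture]` kept per RC-307 (β). WHAT IS NOT CLAIMED: the
statement itself; anything for reducible `E[2]` / CM / analytic rank `1`; lower bounds; `m = 1`.
[cite: Kato2004Asterisque, Thm. 12.5 (3)(4) and (12.5.1) (p. 222), Conj. 12.10 (p. 224), 13.13 (pp. 233–234), 14.14 and Lemma 14.15 (pp. 243–244), Thm. 16.6 (p. 271), §17.13 (p. 280)]
[cite: GreenbergLNM1716, Thm. 1.14 (p. 68)] [cite: MazurTateTeitelbaum1986Invent, §I.17] [cite: CoatesSujatha2005, statement (A) (the hypothesis)] -/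
@[conjecture] def KatoSharpAtTwoAdditiveNegOneSplitTwist : Prop :=
  ∀ (W : WeierstrassCurve ℚ) [W.IsElliptic] [W.IsGloballyMinimal], ¬ W.HasCM →
    ¬ W.HasGoodReductionAtPrime 2 → ¬ W.HasMultiplicativeReductionAtPrime 2 →
    (W.quadraticTwist (-1)).HasSplitMultiplicativeReductionAtPrime 2 →
    W.HasIrreducibleModPGaloisRep 2 →
    (∀ (κ : ZpExtension ℚ 2), κ.IsCyclotomic →
      ∃ (γ : Field.absoluteGaloisGroup ℚ) (D : W.FineSelmerDualData κ γ),
        Module.Finite ℤ_[2] (RestrictScalars ℤ_[2] (IwasawaAlgebra 2) D.X)) →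
    W.entireLFunction 1 ≠ 0 → Finite W.sha →
    ∃ q : ℚ, W.entireLFunction 1 / (W.realPeriodRat : ℂ) = (q : ℂ) ∧
      (padicValNat 2 (Nat.card (AddCommGroup.primaryComponent W.sha 2)) : ℤ) +
          padicValNat 2 W.tamagawaProduct ≤ padicValRat 2 q

/-- [crux, MEMO] **The SHARP Kato-at-`2` bound on the additive (−2)-split-twist block** (39 X5@2 classes, 30 with
irreducible `E[2]`): as `KatoSharpAtTwoAdditiveNegOneSplitTwist` with the twist by `−2` split multiplicative at `2`
(then `W^{(−1)} = (W^{(−2)})^{(2)}` is additive: the two blocks are disjoint). CONTENT = T20 (f): the same transport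
argument with `F = ℚ(√−2)`, the `χ_{−2}`-branch `∫ χ_{−2}(x)(1+T)^{ℓ(x)} dμ⁻` of the one-term measure of
`W^{(−2)}` and `𝔮₀ = (T + 6/5)`, `ι𝔮₀ = (T + 6)`; its object-level input (the twin of §1) is NOT typed today
because that branch has no tree name (vocabulary gap). STATUS: conjecture-grade label unchanged until the twin of §1
is typed; mathematically on the same footing as the (−1)-block. WHAT IS NOT CLAIMED: as above.
[cite: Kato2004Asterisque, Thm. 12.5 (3)(4) and (12.5.1) (p. 222), Conj. 12.10 (p. 224), Thm. 16.6 (p. 271), §17.13 (p. 280)]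
[cite: GreenbergLNM1716, Thm. 1.14 (p. 68)] [cite: MazurTateTeitelbaum1986Invent, §I.17] [cite: CoatesSujatha2005, statement (A) (the hypothesis)] -/
@[conjecture] def KatoSharpAtTwoAdditiveNegTwoSplitTwist : Prop :=
  ∀ (W : WeierstrassCurve ℚ) [W.IsElliptic] [W.IsGloballyMinimal], ¬ W.HasCM →
    ¬ W.HasGoodReductionAtPrime 2 → ¬ W.HasMultiplicativeReductionAtPrime 2 →
    (W.quadraticTwist (-2)).HasSplitMultiplicativeReductionAtPrime 2 →
    W.HasIrreducibleModPGaloisRep 2 →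
    (∀ (κ : ZpExtension ℚ 2), κ.IsCyclotomic →
      ∃ (γ : Field.absoluteGaloisGroup ℚ) (D : W.FineSelmerDualData κ γ),
        Module.Finite ℤ_[2] (RestrictScalars ℤ_[2] (IwasawaAlgebra 2) D.X)) →
    W.entireLFunction 1 ≠ 0 → Finite W.sha →
    ∃ q : ℚ, W.entireLFunction 1 / (W.realPeriodRat : ℂ) = (q : ℂ) ∧
      (padicValNat 2 (Nat.card (AddCommGroup.primaryComponent W.sha 2)) : ℤ) +
          padicValNat 2 W.tamagawaProduct ≤ padicValRat 2 q

/-! ## §3 Pure logic: T19 = (−1)-block ∧ (−2)-block; the per-curve door on the (−1)-block -/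

/-- **T19 from its two blocks** (`KatoSharpAtTwoAdditiveSplitTwist ⟸ (−1)-block ∧ (−2)-block`): the hypothesis
«not (no split twist by `−1` or `−2`)» of T19 is «`W^{(−1)}` split or `W^{(−2)}` split» (classical logic).
[cite: Kato2004Asterisque, Thm. 12.5 (3) and (12.5.1) (p. 222), Conj. 12.10 (p. 224)] -/
theorem katoSharpAtTwoAdditiveSplitTwist_of_negOne_of_negTwo
    (h₁ : KatoSharpAtTwoAdditiveNegOneSplitTwist) (h₂ : KatoSharpAtTwoAdditiveNegTwoSplitTwist) :
    KatoSharpAtTwoAdditiveSplitTwist := by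
  intro W _ _ hcm hgood hmult hst hirr hA hL hfin
  by_cases hneg : (W.quadraticTwist (-1)).HasSplitMultiplicativeReductionAtPrime 2
  · exact h₁ W hcm hgood hmult hneg hirr hA hL hfin
  · have hneg2 : (W.quadraticTwist (-2)).HasSplitMultiplicativeReductionAtPrime 2 := by
      by_contra h2
      exact hst (fun d hd => by
        rcases hd with rfl | rfl
        · exact hneg
        · exact h2)
    exact h₂ W hcm hgood hmult hneg2 hirr hA hL hfin

/-- **Conversely T19 gives each block** (recorded so that either currency may be cited).
[cite: Kato2004Asterisque, Conj. 12.10 (p. 224)] -/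
theorem katoSharpAtTwoAdditiveNegOneSplitTwist_of_splitTwist (hX : KatoSharpAtTwoAdditiveSplitTwist) :
    KatoSharpAtTwoAdditiveNegOneSplitTwist ∧ KatoSharpAtTwoAdditiveNegTwoSplitTwist := by
  refine ⟨fun W _ _ hcm hgood hmult hsp hirr hA hL hfin => hX W hcm hgood hmult ?_ hirr hA hL hfin,
    fun W _ _ hcm hgood hmult hsp hirr hA hL hfin => hX W hcm hgood hmult ?_ hirr hA hL hfin⟩
  · exact fun h => h (-1) (Or.inl rfl) hsp
  · exact fun h => h (-2) (Or.inr rfl) hsp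

/-- **The sharp Kato-at-`2` bound for EVERY additive curve with irreducible `E[2]` from the (NST′) reading
(`hNST2`) and the two block targets** — `katoSharpAtTwoAdditive_of_reading_of_splitTwist` re-keyed.
[cite: Kato2004Asterisque, Thm. 12.5 (3) and (12.5.1) (p. 222), Conj. 12.10 (p. 224)] -/
theorem katoSharpAtTwoAdditive_of_reading_of_negOne_of_negTwo
    (hNST2 : Kato2004.rankZero_padicValNat_sha_add_padicValNat_tamagawa_le_at_two_of_noSplitTwistNegOneNegTwo_of_irreducible_of_fineSelmerDual_fg)
    (h₁ : KatoSharpAtTwoAdditiveNegOneSplitTwist) (h₂ : KatoSharpAtTwoAdditiveNegTwoSplitTwist) :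
    ∀ (W : WeierstrassCurve ℚ) [W.IsElliptic] [W.IsGloballyMinimal], ¬ W.HasCM →
      ¬ W.HasGoodReductionAtPrime 2 → ¬ W.HasMultiplicativeReductionAtPrime 2 →
      W.HasIrreducibleModPGaloisRep 2 →
      (∀ (κ : ZpExtension ℚ 2), κ.IsCyclotomic →
        ∃ (γ : Field.absoluteGaloisGroup ℚ) (D : W.FineSelmerDualData κ γ),
          Module.Finite ℤ_[2] (RestrictScalars ℤ_[2] (IwasawaAlgebra 2) D.X)) →
      W.entireLFunction 1 ≠ 0 → Finite W.sha →
      ∃ q : ℚ, W.entireLFunction 1 / (W.realPeriodRat : ℂ) = (q : ℂ) ∧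
        (padicValNat 2 (Nat.card (AddCommGroup.primaryComponent W.sha 2)) : ℤ) +
            padicValNat 2 W.tamagawaProduct ≤ padicValRat 2 q :=
  katoSharpAtTwoAdditive_of_reading_of_splitTwist hNST2
    (katoSharpAtTwoAdditiveSplitTwist_of_negOne_of_negTwo h₁ h₂)

end Summit.BirchSwinnertonDyer.BirchSwinnertonDyer.Theorems.AddKatoTwo

namespace Summit.BirchSwinnertonDyer.BirchSwinnertonDyer.Theorems.SemistableKatoTwo

open Literature.NumberTheory.EllipticCurves.Rank1Residual Literature.NumberTheory.EllipticCurves.Rank1Residual.Typed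
  Summit.BirchSwinnertonDyer.BirchSwinnertonDyer.Theorems.AddKatoTwo

/-- **The Kato half at an ADDITIVE curve of the (−1)-split-twist block in Miller's currency** (`MissingUpperBoundAt W 2`),
`E[2]` irreducible, from statement (A) at `(E,2)`, GRANTED the block target `KatoSharpAtTwoAdditiveNegOneSplitTwist`
(T20: reading-grade modulo the odd-branch package), GZK and modularity — `missingUpperBoundAt_two_of_katoAtTwoSplitTwist`
re-keyed to the block. [cite: Kato2004Asterisque, Conj. 12.10 (p. 224), Thm. 12.5 (3) and (12.5.1) (p. 222)]
[cite: CoatesSujatha2005, statement (A)] [cite: Miller2011LMS, Def. 1.1] -/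
theorem missingUpperBoundAt_two_of_katoAtTwoNegOneSplitTwist (h₁ : KatoSharpAtTwoAdditiveNegOneSplitTwist)
    (hGZK : rank_eq_analyticRank_of_analyticRank_le_one) (hmod : hasEntireLFunction_rat)
    (W : WeierstrassCurve ℚ) [W.IsElliptic] [W.IsGloballyMinimal] (hcm : ¬ W.HasCM) (hr : W.analyticRank = 0)
    (hadd : Addv W 2) (hsp : (W.quadraticTwist (-1)).HasSplitMultiplicativeReductionAtPrime 2)
    (hirr : W.HasIrreducibleModPGaloisRep 2)
    (hA : ∀ (κ : ZpExtension ℚ 2), κ.IsCyclotomic →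
      ∃ (γ : Field.absoluteGaloisGroup ℚ) (D : W.FineSelmerDualData κ γ),
        Module.Finite ℤ_[2] (RestrictScalars ℤ_[2] (IwasawaAlgebra 2) D.X)) :
    MissingUpperBoundAt W 2 :=
  missingUpperBoundAt_of_katoSharp_at hGZK hmod W hr hirr
    (fun hL hfin => h₁ W hcm hadd.1 hadd.2 hsp hirr hA hL hfin)

/-- The (−2)-block twin of `missingUpperBoundAt_two_of_katoAtTwoNegOneSplitTwist`.
[cite: Kato2004Asterisque, Conj. 12.10 (p. 224)] [cite: CoatesSujatha2005, statement (A)] [cite: Miller2011LMS, Def. 1.1] -/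
theorem missingUpperBoundAt_two_of_katoAtTwoNegTwoSplitTwist (h₂ : KatoSharpAtTwoAdditiveNegTwoSplitTwist)
    (hGZK : rank_eq_analyticRank_of_analyticRank_le_one) (hmod : hasEntireLFunction_rat)
    (W : WeierstrassCurve ℚ) [W.IsElliptic] [W.IsGloballyMinimal] (hcm : ¬ W.HasCM) (hr : W.analyticRank = 0)
    (hadd : Addv W 2) (hsp : (W.quadraticTwist (-2)).HasSplitMultiplicativeReductionAtPrime 2)
    (hirr : W.HasIrreducibleModPGaloisRep 2)
    (hA : ∀ (κ : ZpExtension ℚ 2), κ.IsCyclotomic →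
      ∃ (γ : Field.absoluteGaloisGroup ℚ) (D : W.FineSelmerDualData κ γ),
        Module.Finite ℤ_[2] (RestrictScalars ℤ_[2] (IwasawaAlgebra 2) D.X)) :
    MissingUpperBoundAt W 2 :=
  missingUpperBoundAt_of_katoSharp_at hGZK hmod W hr hirr
    (fun hL hfin => h₂ W hcm hadd.1 hadd.2 hsp hirr hA hL hfin)

end Summit.BirchSwinnertonDyer.BirchSwinnertonDyer.Theorems.SemistableKatoTwo

end
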